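import Mathlib.Analysis.SpecialFunctions.Pow.Complex
import Literature.Geometry.Lorentzian.KerrDeSitter
import HarnessLib

/-!
# The separated Teukolsky equations on Kerr–de Sitter and the quasinormal-mode boundary
# conditions (Suzuki–Takasugi–Umetsu 1998/1999, Hatsuda 2020, Casals–Teixeira da Costa 2022)

Definitions only (no named facts): the fixed-frequency radial and angular Teukolsky ODEs of a
spin-`s` massless field on the subextremal Kerr–de Sitter exterior `r₊ < r < r_c`, the horizon
exponents, the INGOING (future event horizon) / OUTGOING (future cosmological horizon) boundary
conditions, the regularity condition of the angular function at the poles, "mode solution", and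
the resulting `Prop`s "no mode with `(ω, m) ∈ W`" / "mode stability" for a parameter point and for
a parameter box — the statement shape a certified quasinormal-frequency enclosure proves box by box
(venture `Summits/Ventures/KdS`). Vocabulary of `KerrDeSitter.lean` is reused: `xi a Λ = 1 + Λa²/3`
(the sources' `1 + α`, `Ξ`, `χ²`, `b`), `delta M a Λ r = (r² + a²)(1 − Λr²/3) − 2Mr` (`Δ_r`), the
horizon radii `rMinus < rPlus < rCosmo` and `IsSubextremal`.

Sources, read verbatim (materialised TeX of the arXiv versions; equation numbers pinned by the
papers' own cross-references):

* H. Suzuki, E. Takasugi, H. Umetsu, *Perturbations of Kerr–de Sitter black holes and Heun's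
  equations*, Prog. Theor. Phys. 100 (1998) 491–505 [SuzukiTakasugiUmetsu1998]: metric and
  `Δ_r, Δ_θ, α = Λa²/3` (2.1)–(2.2), `K = ω(r²+a²) − am`, separated equations (2.7)–(2.8), the
  angular equation in `x = cos θ` (3.1) and the radial equation (3.7):
  `{Δ_r^{-s} d/dr Δ_r^{s+1} d/dr + (1/Δ_r)[(1+α)²K² − is(1+α)K dΔ_r/dr] + 4is(1+α)ωr`
  `− (2α/a²)(s+1)(2s+1) r² + 2s(1−α) − λ} R = 0`, time dependence `e^{−i(ωt − mφ)}`.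
* Y. Hatsuda, *Quasinormal modes of Kerr–de Sitter black holes via the Heun function*, Class.
  Quantum Grav. 38 (2020) 025015 [Hatsuda2020]: the same two equations, (2.5) (compact angular form,
  `c = aω`) and (2.13)–(2.14) (radial), the exponents `B_h = i(1+α)K(r_h)/Δ_r'(r_h)` (2.18), and
  the QNM boundary condition §3.1: at the event horizon the preferred solution is
  `R ∼ (r − r₊)^{−s − B(r₊)}`, at the cosmological horizon `R ∼ (r_c − r)^{+B(r_c)}`
  ("`R_02` satisfies the QNM boundary condition at the event horizon … `R_11` is a preferred
  solution. The QNM boundary condition then requires `C_22 = 0`").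
* M. Casals, R. Teixeira da Costa, *Hidden spectral symmetries and mode stability of subextremal
  Kerr(–de Sitter) black holes*, Commun. Math. Phys. 394 (2022) 797–832 [CasalsTeixeiradacosta2022],
  §3.2, read in the authors' latest arXiv source (v3, 2023; it supersedes v1 in two places relevant
  here: "The parameter `μ` must be taken to be 1 if `s ≠ 0`" — so their radial equation (3.8) IS the
  STU/Hatsuda equation, `λ̄ = λ − s(1−α) + 2Ξ²amω − a²Ξ²ω²` — and Definition 3.3 says "smooth" where
  v1 said "holomorphic"): Definition 3.3 ("ingoing at `𝓗⁺` if the following are smooth at `r = r₁`: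
  `R(r)(r−r₁)^{−η₁+(s−1)/2}` if either `Re ω ≠ mϖ₁` or `s ≤ 0`, and `R(r)(r−r₁)^{−(s+1)/2}` if
  `Re ω = mϖ₁` and `s ≥ 0`; outgoing at `𝓗⁺_c` if the following are smooth at `r = r₂`:
  `R(r)(r−r₂)^{η₂−(s+1)/2}` if either `Re ω ≠ mϖ₂` or `s ≥ 0`, and `R(r)(r−r₂)^{(s−1)/2}` if
  `Re ω = mϖ₂` and `s ≤ 0`"; `η_j = (−1)^j i(ω − mϖ_j)/(2κ_j)`, (3.10)), Definition 3.4 (mode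
  solution: `ω ≠ 0`, `Im ω ≥ 0`, `s ∈ ½ℤ`, `m − s ∈ ℤ`, the separation constant an angular eigenvalue
  making `e^{imφ}S` a non-trivial smooth spin-weighted function, `R` ingoing at `𝓗⁺` and outgoing at
  `𝓗⁺_c`), Lemma 3.1 (regularity at the poles: `S(θ)(1 + cos θ)^{−|m−s|/2}` holomorphic near
  `θ = π`, `S(θ)(1 − cos θ)^{−|m+s|/2}` near `θ = 0`), and the subextremality discriminant (3.1).
* P. Hintz, O. Petersen, A. Vasy, *Conditional non-linear stability of Kerr–de Sitter spacetimes in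
  the full subextremal range*, arXiv:2508.06620 [HintzPetersenVasy2025], (1.2): the subextremality
  discriminant condition.

## Conventions fixed here

* Spin `s` and azimuthal number `m` are real numbers; statements that need `s ∈ ½ℤ`, `m − s ∈ ℤ`
  say so (`NoModeIn`). Frequency `ω` and separation constant `λ` are complex (quasinormal modes).
* `λ` is the separation constant of STU 1998 = Hatsuda 2020 (NOT the shifted `λ_s` of STU 1999,
  nor CTdC's `λ̄ = λ − s(1−α) + 2Ξ²amω − a²Ξ²ω²`); radial and angular equation share it.
* The radial function is the Teukolsky radial function `R` of STU/Hatsuda (= CTdC's `α^{[s]}`, NOT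
  CTdC's rescaled `R`, `α^{[s]} = Δ^{−(s+1)/2}(r − r₃)R` in the lead-in to their (3.8) — their (3.5)
  prints the factor as `(r − r₃)^{−1}`; either way it is smooth and non-vanishing at `r₁, r₂`, so it
  does not affect the horizon conditions); the boundary conditions are transcribed to it: with
  `Δ = (r − r₁)·q`, `q` smooth and positive near `r₁`, "`R(r)(r−r₁)^{−η₁+(s−1)/2}` smooth at `r₁`"
  ⇔ "`α(r)(r−r₁)^{s+B(r₁)}` smooth at `r₁`" since `B(r₁) = −η₁`, and "`R(r)(r−r₂)^{η₂−(s+1)/2}`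
  smooth at `r₂`" ⇔ "`α(r)(r_c−r)^{−B(r_c)}` smooth at `r_c`" since `B(r₂) = −η₂` (a complex power
  of the negative real `r − r₂` differs from that of `r₂ − r` by a constant phase). "Smooth at `r_h`"
  for a function on `(r₊, r_c)` is rendered as in the tree's Kerr file
  (`Kerr.IsOutgoingAtHorizon`): agreement on a one-sided interval with a function `C^∞` on a
  two-sided neighbourhood (which may vanish at `r_h`). Only the GENERIC bullets of CTdC Def. 3.3 are
  rendered (`Re ω ≠ m ϖ_h`, or the sign of `s` for which the generic bullet is stated to apply always:
  `s ≤ 0` at `𝓗⁺`, `s ≥ 0` at `𝓗⁺_c`); the threshold case `Re ω = m ϖ_h` with the other sign of `s`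
  has a different printed exponent (`−(s+1)/2`, resp. `(s−1)/2`, for their `R`) and is NOT covered by
  `IsIngoingAtEventHorizon`/`IsOutgoingAtCosmoHorizon` — a statement quantifying over CTdC mode
  solutions on those lines must add it. -- TODO(general form): threshold bullets of CTdC Def. 3.3.
* `Δ_r^{-s}(Δ_r^{s+1}R')' = Δ_r R'' + (s+1)Δ_r' R'` (an identity on `{Δ_r > 0} ⊇ (r₊, r_c)`) is
  used to write the radial operator without real powers of `Δ_r`.
-/

noncomputable section

open Complex Set

namespace Literature.Geometry.Lorentzian.KerrDeSitter

/-! ### Parameters and the horizon function -/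

/-- `α = Λa²/3`, the rotation–cosmological-constant parameter of Suzuki–Takasugi–Umetsu
(so that `xi a Λ = 1 + α`). [cite: SuzukiTakasugiUmetsu1998, (2.2)] -/
def alpha (a Λ : ℝ) : ℝ := Λ / 3 * a ^ 2

/-- `Ξ = 1 + α`. [cite: SuzukiTakasugiUmetsu1998, (2.2)] -/
theorem xi_eq_one_add_alpha (a Λ : ℝ) : xi a Λ = 1 + alpha a Λ := rfl

/-- `Δ_r'(r) = 2r(1 − Λr²/3) − (2Λ/3) r (r² + a²) − 2M`, the derivative of the horizon function
`Δ_r = (r²+a²)(1 − Λr²/3) − 2Mr` (enters the radial potential and the horizon exponents).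
[cite: Hatsuda2020, (2.13) and (2.18)] -/
def deltaDeriv (M a Λ r : ℝ) : ℝ := 2 * r * (1 - Λ / 3 * r ^ 2) - 2 * Λ / 3 * r * (r ^ 2 + a ^ 2) - 2 * M

/-- `deltaDeriv` is the derivative of `delta` (the `Δ_r'` of the printed radial equation). [cite: Hatsuda2020, (2.13)] -/
theorem hasDerivAt_delta (M a Λ r : ℝ) :
    HasDerivAt (fun r => delta M a Λ r) (deltaDeriv M a Λ r) r := by
  have h1 : HasDerivAt (fun r : ℝ => r ^ 2 + a ^ 2) (2 * r) r := by
    simpa using (hasDerivAt_pow 2 r).add_const (a ^ 2)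
  have h2 : HasDerivAt (fun r : ℝ => 1 - Λ / 3 * r ^ 2) (-(Λ / 3 * (2 * r))) r := by
    simpa using ((hasDerivAt_pow 2 r).const_mul (Λ / 3)).const_sub 1
  have h3 : HasDerivAt (fun r : ℝ => 2 * M * r) (2 * M) r := by
    simpa using (hasDerivAt_id r).const_mul (2 * M)
  have h := (h1.mul h2).sub h3
  refine h.congr_deriv ?_
  unfold deltaDeriv
  ring

/-- The fourth (negative) root `r₋' = −(r₋ + r₊ + r_c)` of `Δ_r` ("a trivial relation
`r₊ + r₊' + r₋ + r₋' = 0`": the cubic coefficient of `Δ_r` vanishes). [cite: Hatsuda2020, §2.2 (below (2.21))] -/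
def rNeg (M a Λ : ℝ) : ℝ := -(rMinus M a Λ + rPlus M a Λ + rCosmo M a Λ)

/-! ### Fixed-frequency data of the radial equation -/

/-- `K(r) = ω(r² + a²) − am` (complex frequency `ω`, azimuthal number `m`).
[cite: Hatsuda2020, (2.14)] -/
def radialK (a : ℝ) (ω : ℂ) (m : ℝ) (r : ℝ) : ℂ := ω * ((r ^ 2 + a ^ 2 : ℝ) : ℂ) - ((a * m : ℝ) : ℂ)

/-- The **horizon exponent** `B(r_h) = i(1+α)K(r_h)/Δ_r'(r_h)` at a simple root `r_h` of `Δ_r`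
(Hatsuda's `B₁, B₂, B₃` at `r₊, r₊', r₋'`): the local exponents of the radial Teukolsky function at
`r_h` are `B(r_h)` and `−s − B(r_h)`. In Casals–Teixeira da Costa's notation `B(r₁) = −η₁`,
`B(r₂) = −η₂` (`η_j = (−1)^j i(ω − mϖ_j)/(2κ_j)`). [cite: Hatsuda2020, (2.18)] -/
def horizonB (M a Λ : ℝ) (ω : ℂ) (m : ℝ) (rh : ℝ) : ℂ :=
  I * (xi a Λ : ℂ) * radialK a ω m rh / (deltaDeriv M a Λ rh : ℂ)

/-- The zeroth-order coefficient of the radial Teukolsky equation (STU 1998 (3.7) with `Q = 0`;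
Hatsuda 2020 (2.13)):
`(1/Δ_r)[(1+α)²K² − is(1+α)KΔ_r'] + 4is(1+α)ωr − (2α/a²)(s+1)(2s+1)r² + 2s(1−α) − λ`
(`2α/a² = 2Λ/3`). [cite: SuzukiTakasugiUmetsu1998, (3.7)] -/
def radialPotential (M a Λ s : ℝ) (ω : ℂ) (m : ℝ) (lam : ℂ) (r : ℝ) : ℂ :=
  ((xi a Λ : ℂ) ^ 2 * radialK a ω m r ^ 2 -
        I * (s : ℂ) * (xi a Λ : ℂ) * radialK a ω m r * (deltaDeriv M a Λ r : ℂ)) /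
      (delta M a Λ r : ℂ) +
    4 * I * (s : ℂ) * (xi a Λ : ℂ) * ω * (r : ℂ) -
    ((2 * Λ / 3 * (s + 1) * (2 * s + 1) * r ^ 2 : ℝ) : ℂ) +
    ((2 * s * (1 - alpha a Λ) : ℝ) : ℂ) - lam

/-- **Classical solutions of the radial Teukolsky equation on the Kerr–de Sitter exterior**
`(r₊, r_c)` with spin `s`, frequency `ω`, azimuthal number `m` and separation constant `λ`
(STU 1998 (3.7) at `Q = 0` = Hatsuda 2020 (2.13)):
`Δ_r^{-s}(Δ_r^{s+1}R')' + ((1+α)²K² − is(1+α)KΔ_r')/Δ_r · R`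
`+ (4is(1+α)ωr − (2α/a²)(s+1)(2s+1)r² + 2s(1−α) − λ) R = 0`,
with the first term expanded as `Δ_r R'' + (s+1)Δ_r' R'`: `R` is twice differentiable at every
`r ∈ (r₊, r_c)` with derivatives `R'`, `R''` and the equation holds pointwise there.
[cite: SuzukiTakasugiUmetsu1998, (3.7)] -/
def IsRadialTeukolskySolution (M a Λ s : ℝ) (ω : ℂ) (m : ℝ) (lam : ℂ) (R : ℝ → ℂ) : Prop :=
  ∃ R' R'' : ℝ → ℂ, ∀ r ∈ Ioo (rPlus M a Λ) (rCosmo M a Λ),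
    HasDerivAt R (R' r) r ∧ HasDerivAt R' (R'' r) r ∧
      (delta M a Λ r : ℂ) * R'' r + ((s + 1 : ℝ) : ℂ) * (deltaDeriv M a Λ r : ℂ) * R' r +
          radialPotential M a Λ s ω m lam r * R r = 0

/-- **Ingoing boundary condition at the future event horizon `𝓗⁺`** (generic case): the radial
function behaves like the local solution with exponent `−s − B(r₊)`, i.e. "`R(r)(r − r₊)^{s+B(r₊)}`
is smooth at `r = r₊`": it agrees on some `(r₊, r₊ + ε)` with a function `C^∞` on
`(r₊ − ε, r₊ + ε)` (principal complex power of the positive real `r − r₊`; the smooth function may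
vanish at `r₊`). Casals–Teixeira da Costa Def. 3.3, first bullet ("ingoing at `𝓗⁺` if the following
are smooth at `r = r₁`: `R(r)(r−r₁)^{−η₁+(s−1)/2}` if either `Re ω ≠ mϖ₁` or `s ≤ 0`", for their
`R = (r−r₃)^{∓1}Δ^{(s+1)/2}α`, `B(r₁) = −η₁`); Hatsuda §3.1 ("`R_02(r) ∼ (r−r₊)^{−s−iωr₊²/Δ_r'(r₊)}`
… satisfies the QNM boundary condition at the event horizon"); STU 1999 §2 (`A₁ = A₁₋`).
[cite: CasalsTeixeiradacosta2022, Definition 3.3] -/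
def IsIngoingAtEventHorizon (M a Λ s : ℝ) (ω : ℂ) (m : ℝ) (R : ℝ → ℂ) : Prop :=
  ∃ ε : ℝ, 0 < ε ∧ ∃ f : ℝ → ℂ,
    ContDiffOn ℝ ((⊤ : ℕ∞) : WithTop ℕ∞) f (Ioo (rPlus M a Λ - ε) (rPlus M a Λ + ε)) ∧
      ∀ r ∈ Ioo (rPlus M a Λ) (rPlus M a Λ + ε),
        R r * ((r - rPlus M a Λ : ℝ) : ℂ) ^ ((s : ℂ) + horizonB M a Λ ω m (rPlus M a Λ)) = f r

/-- **Outgoing boundary condition at the future cosmological horizon `𝓗⁺_c`** (generic case):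
the radial function behaves like the local solution with exponent `+B(r_c)` in `(r_c − r)`, i.e.
"`R(r)(r_c − r)^{−B(r_c)}` is smooth at `r = r_c`": it agrees on some `(r_c − ε, r_c)` with a
function `C^∞` on `(r_c − ε, r_c + ε)`. Casals–Teixeira da Costa Def. 3.3 ("outgoing at `𝓗⁺_c` if
the following are smooth at `r = r₂`: `R(r)(r−r₂)^{η₂−(s+1)/2}` if either `Re ω ≠ mϖ₂` or
`s ≥ 0`", `B(r₂) = −η₂`); Hatsuda §3.1 ("`R_11(r) ∼ (r₊'−r)^{iωr₊'²/Δ_r'(r₊')}` … is a preferred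
solution"). [cite: CasalsTeixeiradacosta2022, Definition 3.3] -/
def IsOutgoingAtCosmoHorizon (M a Λ : ℝ) (ω : ℂ) (m : ℝ) (R : ℝ → ℂ) : Prop :=
  ∃ ε : ℝ, 0 < ε ∧ ∃ f : ℝ → ℂ,
    ContDiffOn ℝ ((⊤ : ℕ∞) : WithTop ℕ∞) f (Ioo (rCosmo M a Λ - ε) (rCosmo M a Λ + ε)) ∧
      ∀ r ∈ Ioo (rCosmo M a Λ - ε) (rCosmo M a Λ),
        R r * ((rCosmo M a Λ - r : ℝ) : ℂ) ^ (-horizonB M a Λ ω m (rCosmo M a Λ)) = f r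

/-! ### The angular equation and regularity at the poles -/

/-- The zeroth-order coefficient of the angular Teukolsky equation in `x = cos θ`, `c = aω`
(Hatsuda 2020 (2.5), "a more compact form" of STU 1998 (3.1)):
`λ − s(1−α) − 2αx² + ((1+α)²/(1+αx²))(c²x² − 2csx − c² + 2cm + (4α/(1+α))smx − (m+sx)²/(1−x²))`.
[cite: Hatsuda2020, (2.5)] -/
def angularPotential (a Λ s : ℝ) (ω : ℂ) (m : ℝ) (lam : ℂ) (x : ℝ) : ℂ :=
  lam - ((s * (1 - alpha a Λ) : ℝ) : ℂ) - ((2 * alpha a Λ * x ^ 2 : ℝ) : ℂ) +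
    (((1 + alpha a Λ) ^ 2 / (1 + alpha a Λ * x ^ 2) : ℝ) : ℂ) *
      (((a : ℂ) * ω) ^ 2 * (x : ℂ) ^ 2 - 2 * ((a : ℂ) * ω) * (s : ℂ) * (x : ℂ) - ((a : ℂ) * ω) ^ 2 +
          2 * ((a : ℂ) * ω) * (m : ℂ) + ((4 * alpha a Λ / (1 + alpha a Λ) * s * m * x : ℝ) : ℂ) -
        (((m + s * x) ^ 2 / (1 - x ^ 2) : ℝ) : ℂ))

/-- **Classical solutions of the angular Teukolsky equation** on `x = cos θ ∈ (−1, 1)`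
(Hatsuda 2020 (2.5) = STU 1998 (3.1)):
`[d/dx (1+αx²)(1−x²) d/dx + angularPotential] S = 0`, with the Sturm–Liouville term expanded as
`(1+αx²)(1−x²)S'' + (2(α−1)x − 4αx³)S'`. [cite: Hatsuda2020, (2.5)] -/
def IsAngularTeukolskySolution (a Λ s : ℝ) (ω : ℂ) (m : ℝ) (lam : ℂ) (S : ℝ → ℂ) : Prop :=
  ∃ S' S'' : ℝ → ℂ, ∀ x ∈ Ioo (-1 : ℝ) 1,
    HasDerivAt S (S' x) x ∧ HasDerivAt S' (S'' x) x ∧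
      (((1 + alpha a Λ * x ^ 2) * (1 - x ^ 2) : ℝ) : ℂ) * S'' x +
            ((2 * (alpha a Λ - 1) * x - 4 * alpha a Λ * x ^ 3 : ℝ) : ℂ) * S' x +
          angularPotential a Λ s ω m lam x * S x = 0

/-- **Regularity of the angular function at the poles** `x = ∓1` (`θ = π, 0`): `S` is the
admissible Frobenius branch at each pole, `S(x) = (1+x)^{|m−s|/2}·g₋(x)` near `x = −1` and
`S(x) = (1−x)^{|m+s|/2}·g₊(x)` near `x = 1` with `g_∓` smooth across the pole (Hatsuda §3.2: near
`x = −1` the local solutions behave as `(1+x)^{±(m−s)/2}`, near `x = 1` as `(1−x)^{∓(m+s)/2}`, and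
regularity selects `(1+x)^{|m−s|/2}`, `(1−x)^{|m+s|/2}`) — the condition making `e^{imφ}S(θ)` a smooth
`s`-spin-weighted function on `S²` (Casals–Teixeira da Costa Lemma 3.1: "`S(θ)(1+cos θ)^{−|m−s|/2}`
is holomorphic in `θ ∈ (0,π]`, and `S(θ)(1−cos θ)^{−|m+s|/2}` is holomorphic in `θ ∈ [0,π)`"; for
solutions of the angular equation the smooth, analytic and holomorphic-in-`θ` versions single out the
same branch). [cite: CasalsTeixeiradacosta2022, Lemma 3.1] -/
def IsRegularAtPoles (s m : ℝ) (S : ℝ → ℂ) : Prop :=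
  (∃ ε : ℝ, 0 < ε ∧ ∃ g : ℝ → ℂ, ContDiffOn ℝ ((⊤ : ℕ∞) : WithTop ℕ∞) g (Ioo (-1 - ε) (-1 + ε)) ∧
      ∀ x ∈ Ioo (-1 : ℝ) (-1 + ε), S x = ((1 + x : ℝ) : ℂ) ^ ((|m - s| / 2 : ℝ) : ℂ) * g x) ∧
    ∃ ε : ℝ, 0 < ε ∧ ∃ g : ℝ → ℂ, ContDiffOn ℝ ((⊤ : ℕ∞) : WithTop ℕ∞) g (Ioo (1 - ε) (1 + ε)) ∧
      ∀ x ∈ Ioo (1 - ε : ℝ) 1, S x = ((1 - x : ℝ) : ℂ) ^ ((|m + s| / 2 : ℝ) : ℂ) * g x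

/-- `λ` is an **angular eigenvalue** for `(s, m, c = aω)`: the angular equation has a non-trivial
solution regular at both poles ("`λ` is a separation constant, which is determined by a requirement
of the regularity for `S(x)` both at `x = ±1`"). [cite: Hatsuda2020, §2.1 (below (2.5))] -/
def IsAngularEigenvalue (a Λ s : ℝ) (ω : ℂ) (m : ℝ) (lam : ℂ) : Prop :=
  ∃ S : ℝ → ℂ, IsAngularTeukolskySolution a Λ s ω m lam S ∧ IsRegularAtPoles s m S ∧
    ∃ x ∈ Ioo (-1 : ℝ) 1, S x ≠ 0

/-! ### Mode solutions and mode stability -/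

/-- **Mode solution** of the Teukolsky equation on subextremal Kerr–de Sitter with frequency `ω`
and azimuthal number `m` (Casals–Teixeira da Costa Def. 3.4, generic boundary bullets): the
separation constant `λ` is an angular eigenvalue and the radial function is a non-trivial classical
solution on `(r₊, r_c)`, ingoing at `𝓗⁺` and outgoing at `𝓗⁺_c`.
[cite: CasalsTeixeiradacosta2022, Definition 3.4] -/
def IsModeSolution (M a Λ s : ℝ) (ω : ℂ) (m : ℝ) (lam : ℂ) (R : ℝ → ℂ) : Prop :=
  IsAngularEigenvalue a Λ s ω m lam ∧ IsRadialTeukolskySolution M a Λ s ω m lam R ∧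
    IsIngoingAtEventHorizon M a Λ s ω m R ∧ IsOutgoingAtCosmoHorizon M a Λ ω m R ∧
      ∃ r ∈ Ioo (rPlus M a Λ) (rCosmo M a Λ), R r ≠ 0

/-- `(ω, m)` carries a mode: some separation constant and radial function form a mode solution.
[cite: CasalsTeixeiradacosta2022, Definition 3.4] -/
def HasMode (M a Λ s : ℝ) (ω : ℂ) (m : ℝ) : Prop :=
  ∃ (lam : ℂ) (R : ℝ → ℂ), IsModeSolution M a Λ s ω m lam R

/-- **No mode in the window `W`**: for every `(ω, m) ∈ W` with `m` admissible for the spin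
(`m − s ∈ ℤ`, CTdC Def. 3.4) there is no mode solution. This is the box-by-box statement a certified
enclosure of the quasinormal spectrum establishes (e.g. `W = {Im ω ≥ 0, ω ≠ 0, |ω| ≤ Ω, |m| ≤ m₀}`).
[cite: CasalsTeixeiradacosta2022, Definition 3.4] -/
def NoModeIn (M a Λ s : ℝ) (W : Set (ℂ × ℝ)) : Prop :=
  ∀ ω : ℂ, ∀ m : ℝ, (ω, m) ∈ W → (∃ k : ℤ, m - s = k) → ¬HasMode M a Λ s ω m

/-- The closed upper half-plane minus the origin, paired with every azimuthal number: the window of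
**mode stability** (CTdC Def. 3.4: `ω ∈ ℂ ∖ {0}` with `Im ω ≥ 0`).
[cite: CasalsTeixeiradacosta2022, Definition 3.4] -/
def unstableWindow : Set (ℂ × ℝ) := {p | 0 ≤ p.1.im ∧ p.1 ≠ 0}

/-- **Mode stability of the spin-`s` Teukolsky equation at the parameter point `(M, a, Λ)`**:
no mode solution with `Im ω ≥ 0`, `ω ≠ 0` (any admissible `m`). For `Λ = 0` this is Whiting 1989 /
Teixeira da Costa 2020; for `Λ > 0` it is printed as open beyond Casals–Teixeira da Costa's
Theorem 2 and Hintz's small-`ΛM²` scalar result, and it is (at the Teukolsky level) the input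
"mode stability" of the conditional full-range nonlinear stability theorem
(Hintz–Petersen–Vasy 2025, Assumption 1.2 / Theorem 1.4, stated there tensorially).
[cite: CasalsTeixeiradacosta2022, Definition 3.4 and Theorem 2] -/
def ModeStable (M a Λ s : ℝ) : Prop := NoModeIn M a Λ s unstableWindow

/-- Mode stability on a parameter box `B ⊆ {(M, a, Λ)}` (each point of the box is mode stable).
[cite: CasalsTeixeiradacosta2022, Definition 3.4] -/
def ModeStableOn (B : Set (ℝ × ℝ × ℝ)) (s : ℝ) : Prop :=
  ∀ p ∈ B, ModeStable p.1 p.2.1 p.2.2 s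

/-! ### Subextremality discriminants, as printed -/

/-- Hintz–Petersen–Vasy's discriminant: the parameters `(m, a, Λ)` (mass `m`) are subextremal —
`μ(r) = (r²+a²)(1 − Λr²/3) − 2mr` has four distinct real roots — iff
`−(1 + Λa²/3)⁴(a/m)² + 12(1 − Λa²/3)Λa² + (1 − Λa²/3)³ − 9Λm² > 0`.
[cite: HintzPetersenVasy2025, (1.2)] -/
def subextremalDiscriminantHPV (M a Λ : ℝ) : ℝ :=
  -(1 + Λ * a ^ 2 / 3) ^ 4 * (a / M) ^ 2 + 12 * (1 - Λ * a ^ 2 / 3) * Λ * a ^ 2 +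
    (1 - Λ * a ^ 2 / 3) ^ 3 - 9 * Λ * M ^ 2

/-- Casals–Teixeira da Costa's discriminant (`L² = 3/Λ`, `Ξ = 1 + a²/L²`): subextremality is
`27M⁴ + L⁴(Ξ − 1)Ξ⁴ + L²M²(Ξ − 2)(−32 + Ξ(32 + Ξ)) < 0`.
[cite: CasalsTeixeiradacosta2022, (3.1)–(3.2)] -/
def subextremalDiscriminantCTdC (M a Λ : ℝ) : ℝ :=
  27 * M ^ 4 + (3 / Λ) ^ 2 * (xi a Λ - 1) * xi a Λ ^ 4 +
    3 / Λ * M ^ 2 * (xi a Λ - 2) * (-32 + xi a Λ * (32 + xi a Λ))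

/-! ### Elementary API -/

/-- At `a = 0` (Schwarzschild–de Sitter) the HPV discriminant condition is `1 − 9ΛM² > 0`.
[cite: HintzPetersenVasy2025, (1.2)] -/
theorem subextremalDiscriminantHPV_zero_a (M Λ : ℝ) :
    subextremalDiscriminantHPV M 0 Λ = 1 - 9 * Λ * M ^ 2 := by
  simp [subextremalDiscriminantHPV]

/-- At `a = 0` the CTdC discriminant is `27M⁴ − (3/Λ)M²` (negative iff `9ΛM² < 1` for `M, Λ > 0`).
[cite: CasalsTeixeiradacosta2022, (3.1)] -/
theorem subextremalDiscriminantCTdC_zero_a (M Λ : ℝ) :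
    subextremalDiscriminantCTdC M 0 Λ = 27 * M ^ 4 - 3 / Λ * M ^ 2 := by
  simp [subextremalDiscriminantCTdC, xi]
  ring

/-- The two printed discriminants are proportional: `D_CTdC = −(3M²/Λ)·D_HPV` (so `D_CTdC < 0 ⇔
D_HPV > 0` for `M ≠ 0`, `Λ > 0`): the two printed subextremality conditions coincide. [cite: CasalsTeixeiradacosta2022, (3.1)] -/
theorem subextremalDiscriminantCTdC_eq (M a Λ : ℝ) (hM : M ≠ 0) (hΛ : Λ ≠ 0) :
    subextremalDiscriminantCTdC M a Λ = -(3 * M ^ 2 / Λ) * subextremalDiscriminantHPV M a Λ := by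
  unfold subextremalDiscriminantCTdC subextremalDiscriminantHPV xi
  field_simp
  ring

/-- Shrinking the window preserves "no mode" (immediate from the definition). [cite: CasalsTeixeiradacosta2022, Definition 3.4] -/
theorem NoModeIn.mono {M a Λ s : ℝ} {W W' : Set (ℂ × ℝ)} (h : NoModeIn M a Λ s W) (hW : W' ⊆ W) :
    NoModeIn M a Λ s W' :=
  fun ω m hm hadm => h ω m (hW hm) hadm

/-- "No mode" in a union of windows is "no mode" in each (immediate from the definition). [cite: CasalsTeixeiradacosta2022, Definition 3.4] -/
theorem noModeIn_union {M a Λ s : ℝ} {W W' : Set (ℂ × ℝ)} :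
    NoModeIn M a Λ s (W ∪ W') ↔ NoModeIn M a Λ s W ∧ NoModeIn M a Λ s W' :=
  ⟨fun h => ⟨h.mono subset_union_left, h.mono subset_union_right⟩,
    fun h ω m hm hadm => hm.elim (fun hm => h.1 ω m hm hadm) (fun hm => h.2 ω m hm hadm)⟩

/-- Mode stability at a point is "no mode" in any family of windows covering the unstable window
(how box certificates in the frequency plane assemble; immediate from the definition). [cite: CasalsTeixeiradacosta2022, Definition 3.4] -/
theorem modeStable_of_cover {M a Λ s : ℝ} {ι : Type*} (W : ι → Set (ℂ × ℝ))
    (hcover : unstableWindow ⊆ ⋃ i, W i) (h : ∀ i, NoModeIn M a Λ s (W i)) : ModeStable M a Λ s := by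
  intro ω m hm hadm
  obtain ⟨i, hi⟩ := mem_iUnion.1 (hcover hm)
  exact h i ω m hi hadm

/-- Shrinking the parameter box preserves mode stability on it (immediate from the definition). [cite: CasalsTeixeiradacosta2022, Definition 3.4] -/
theorem ModeStableOn.mono {B B' : Set (ℝ × ℝ × ℝ)} {s : ℝ} (h : ModeStableOn B s) (hB : B' ⊆ B) :
    ModeStableOn B' s :=
  fun p hp => h p (hB hp)

/-- Mode stability on a union of boxes is mode stability on each (box-by-box assembly; immediate from the definition). [cite: CasalsTeixeiradacosta2022, Definition 3.4] -/
theorem modeStableOn_iUnion {ι : Type*} {B : ι → Set (ℝ × ℝ × ℝ)} {s : ℝ} :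
    ModeStableOn (⋃ i, B i) s ↔ ∀ i, ModeStableOn (B i) s :=
  ⟨fun h i => h.mono (subset_iUnion B i), fun h p hp => by
    obtain ⟨i, hi⟩ := mem_iUnion.1 hp
    exact h i p hi⟩

/-! ### Sanity: the zero function is a radial solution satisfying both boundary conditions, and is
never a mode (so `HasMode` has content only through non-triviality) -/

/-- The zero function solves the radial equation (sanity instance of the printed ODE). [cite: SuzukiTakasugiUmetsu1998, (3.7)] -/
theorem isRadialTeukolskySolution_zero (M a Λ s : ℝ) (ω : ℂ) (m : ℝ) (lam : ℂ) :
    IsRadialTeukolskySolution M a Λ s ω m lam (fun _ => 0) := by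
  refine ⟨fun _ => 0, fun _ => 0, fun r _ => ⟨hasDerivAt_const r 0, hasDerivAt_const r 0, ?_⟩⟩
  simp

/-- The zero function is ingoing at `𝓗⁺` (sanity instance of the printed boundary condition). [cite: CasalsTeixeiradacosta2022, Definition 3.3] -/
theorem isIngoingAtEventHorizon_zero (M a Λ s : ℝ) (ω : ℂ) (m : ℝ) :
    IsIngoingAtEventHorizon M a Λ s ω m (fun _ => 0) :=
  ⟨1, one_pos, fun _ => 0, contDiffOn_const, fun r _ => by simp⟩

/-- The zero function is outgoing at `𝓗⁺_c` (sanity instance of the printed boundary condition). [cite: CasalsTeixeiradacosta2022, Definition 3.3] -/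
theorem isOutgoingAtCosmoHorizon_zero (M a Λ : ℝ) (ω : ℂ) (m : ℝ) :
    IsOutgoingAtCosmoHorizon M a Λ ω m (fun _ => 0) :=
  ⟨1, one_pos, fun _ => 0, contDiffOn_const, fun r _ => by simp⟩

/-- The zero radial function is never a mode solution ("non-trivial" in the printed definition). [cite: CasalsTeixeiradacosta2022, Definition 3.4] -/
theorem not_isModeSolution_zero (M a Λ s : ℝ) (ω : ℂ) (m : ℝ) (lam : ℂ) :
    ¬IsModeSolution M a Λ s ω m lam (fun _ => 0) := by
  rintro ⟨-, -, -, -, r, -, hr⟩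
  exact hr rfl

end Literature.Geometry.Lorentzian.KerrDeSitter

end
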